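import Literature.Computability.Cryptography.ChenQuantumLWEChirpFourier

/-!
# The class twirl of Chen's chirped coset state: offset-oblivious processing is secret-blind (T4)

REPRODUCTION / ANALYSIS OF A CLAIMED RESULT UNDER ADJUDICATION (withdrawn): Yilei Chen, *Quantum
Algorithms for Lattice Problems*, IACR ePrint 2024/555, version of 2024-04-18 [ChenQuantumLattice2024]
(the version carrying the author's note that Step 9 contains a bug), Step 9 (§3.5.9, pp. 34–38) acting
on `|φ8.b⟩ = Σ_{j ∈ ℤ_P} e(-j²/P) |2D²j·b + v′ mod N⟩` (p. 35), `P = p₁Q`, `N = D²P`.  Bundle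
`papers/QuantumAdvantage/lwe-quantum-autopsy/`, Part 2 (`REPAIR-CENSUS.md` §1 theorem **T4** and §9),
companion of `ChenQuantumLWEChirpFourier.lean` (flat spectrum T3, oracle kick G1/T5).
HONEST FRAMING: kernel-checked THEOREMS about a state occurring in a WITHDRAWN algorithm — a precise
NEGATIVE result (a no-go for a whole class of repairs), NOT summit progress, no cryptanalytic claim in
either direction, no new algorithm; quantum lower bounds are out of scope.

## What is proved

The offset `v′` of `|φ8.b⟩` is unknown and fresh in every run; what the algorithm can learn about it
without the secret is limited (Step 8 = Claim 3.14 gives `v′₀ mod D²p₁`; register functions constant on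
every admissible line give the class of `v′` modulo the span of the admissible directions —
`REPAIR-CENSUS.md` §0).  Fix a set `U` of UNKNOWN coordinates of `b` (the positions of the LWE secret
and error, eq. (12) p. 17: there `b_i ∈ 2p₁ℤ`), a public integer vector `bk` agreeing with `b` off `U`
(e.g. the planted part `(−1, 2p₁p₂, …, 2p₁p_κ, 0, …, 0)`), and the CLASS SHIFTS
`d(a,c) = D²p₁·(a·bk + c·𝟙_U) ∈ ℤ^{n+1}`, `a ∈ ℤ_Q`, `c ∈ ℤ_Q^{n+1}` (`classShift`; only the
`U`-coordinates of `c` enter).  Every `d(a,c)` is `≡ 0 (mod D²p₁)` in coordinate `0` and lies in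
`D²p₁ℤ^{n+1}`, so `v′` and `v′ + d(a,c)` receive the same Step-8 value and the same values of all line
invariants (§0 of the census: reduced mod `N`, and for odd `Q`, the `d(a,c)` run over exactly the residual
class `K` there, each element equally often — `(a,c) ↦ d(a,c) mod N` is a homomorphism and Chen's factor
`2` in `Δ₀ = 2D²(…)` is a unit mod `Q`).
For the Fourier-side Gram entries `ρ̂_{b,v′}(u,u′) = QFT|φ8.b⟩(u) · conj QFT|φ8.b⟩(u′)` (`fourierGram`;
Chen's unnormalised `QFT`, Lemma 2.12) we prove, with NO parity or coprimality hypothesis: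

* `fourierGram_eq`: `ρ̂_{b,v′}(u,u′) = ψ_N(⟨v′,u′−u⟩) · ψ_P(t(u)² − t(u′)²) · |G|²`, `t = lineFun b`
  (`= ⟨b, · mod P⟩`), `G = Σ_j ψ_P(−j²)` (completing the square in the line Gauss sum, `lineGauss_eq`).
* `fourierGram_shift`: shifting the offset by `d` multiplies `ρ̂(u,u′)` by `ψ_N(⟨d, u′−u⟩)`.
* `twirlFactor_eq` (character orthogonality): `Σ_{a,c} ψ_N(⟨d(a,c), η⟩) = Q·[⟨bk,η mod P⟩ ≡ 0 (Q)] ·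
  Π_i Q·[i ∈ U → η_i ≡ 0 (Q)]` — the CLASS TWIRL `ρ̄ = Σ_{a,c} ρ̂_{b,v′+d(a,c)}` (`twirledGram`) kills
  every entry `(u,u′)` with `u′ − u ∉ K^⊥` (`twirledGram_eq`).
* `fourierGram_indep_of_ann` (**the heart of T4**): on the surviving entries (`u′−u ∈ K^⊥`) the entry
  `ρ̂_{b,v′}(u,u′)` is THE SAME for any two vectors `b, b′` that agree off `U` and are `≡ 0 (mod p₁)` on
  `U` — the unknown coordinates drop out of `t(u)² − t(u′)²`.
* `twirledGram_self` (non-vacuity): `ρ̄(u,u) = Q^{n+2}·P ≠ 0` (odd `P`) — the operators equated below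
  are not zero.
* **`twirledGram_secret_indep`** (T4): hence `ρ̄_{b,v′}(u,u′) = ρ̄_{b′,v′}(u,u′)` for ALL `u, u′, v′`:
  the class-averaged (unnormalised) density operator of the run is the same operator for every secret in
  the instance class.  Corollaries: `twirl_statistic_indep` (every sesquilinear statistic
  `Σ_{u,u′} E(u,u′) ρ̄(u,u′)` — every POVM element, after any unitary post-processing of ALL registers —
  has the same value for `b` and `b′`), `twirl_multiRun_indep` (independent runs: the joint averaged
  state is the tensor product, its Gram entries are products — adaptive / collective measurements over
  many runs included), and the `Shape`-level forms `Shape.fourierGram_phi8b`, `Shape.twirledGram_indep`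
  (every admissible shape vs. any `b₂` with the same planted part and `2p₁ ∣ b₂` on `U ∌ 0`).

Reading (census T4 / H1, E2, G2, G4, G5, C1): a post-processing of `|φ8.b⟩` whose description uses only
public data and the side information that does not separate `v′` from `v′ + d(a,c)` ("offset-oblivious";
Chen's Step 9 is of this kind) sees, on average over the class, a state that does not depend on the LWE
secret inside `b`; in particular a relation output with certainty for every offset of the class holds for
every secret of the class simultaneously.  With `ChenQuantumLWEChirpFourier`: the one thing that breaks
obliviousness is the datum `v′₀ mod P` (`oracleKick_congr`, `centreError_eq_zero_iff`) — Zhang's AC4.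

## What is NOT here

The identification of the shifts `d(a,c)` with ALL offset information obtainable without the secret is
the census's hand argument (§0, (i)–(ii)); sharpness of the class (finer offset knowledge does separate
secrets, census T4 "sharp") is not formalised; nothing about Steps 1–8; no normalisation is needed (both
sides are the same unnormalised operator, so traces and normalised states agree too).  The exact value
`|G|² = P` (odd `P`) is `norm_sq_lineGauss_zero`, not used by T4.

References: [ChenQuantumLattice2024] as above; [ZhangExactCoset2025] Y. Zhang, arXiv:2509.12341, p. 22
(AC4); [Korobov1992] Ch. I §3 (quadratic Gauss sums, via `Literature.NumberTheory.GaussSums`).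
-/

namespace Literature.Computability.Cryptography.Chen2024

open scoped BigOperators

/-! ### `ℤ_P → ℤ_Q` for `P = p₁Q`, and the second two-modulus identity -/

section ModQ

variable (p₁ Q : ℕ+)

/-- `ℤ_Q` (the modulus of the missing datum `v′₀ mod Q`). [folklore] -/
abbrev ZQ (Q : ℕ+) : Type := ZMod ((Q : ℕ+) : ℕ)

/-- `Q ∣ P` for `P = p₁Q`. [folklore] -/
theorem Q_dvd_p₁Q : ((Q : ℕ+) : ℕ) ∣ ((p₁ * Q : ℕ+) : ℕ) :=
  ⟨p₁, by rw [PNat.mul_coe, mul_comm]⟩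

/-- The reduction map `ℤ_P →+* ℤ_Q`, `P = p₁Q`. [folklore] -/
def toQ : ZP p₁ Q →+* ZQ Q :=
  ZMod.castHom (Q_dvd_p₁Q p₁ Q) (ZQ Q)

/-- **Second two-modulus identity.** `ψ_P(p₁·x) = ψ_Q(x mod Q)` for `P = p₁Q`. [folklore] -/
theorem stdAddChar_p₁_mul (x : ZP p₁ Q) :
    (ZMod.stdAddChar (((p₁ : ℕ) : ZP p₁ Q) * x) : ℂ) = ZMod.stdAddChar (toQ p₁ Q x) := by
  obtain ⟨t, rfl⟩ : ∃ t : ℕ, (t : ZP p₁ Q) = x := ⟨x.val, ZMod.natCast_zmod_val x⟩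
  have h1 : ((p₁ : ℕ) : ZP p₁ Q) * ((t : ℕ) : ZP p₁ Q)
      = ((((p₁ : ℕ) : ℤ) * ((t : ℕ) : ℤ) : ℤ) : ZP p₁ Q) := by
    simp only [Int.cast_mul, Int.cast_natCast]
  have h2 : toQ p₁ Q ((t : ℕ) : ZP p₁ Q) = (((t : ℕ) : ℤ) : ZQ Q) := by
    rw [map_natCast]; simp only [Int.cast_natCast]
  rw [h1, h2, ZMod.stdAddChar_coe, ZMod.stdAddChar_coe]
  congr 1
  have hp : ((p₁ : ℕ) : ℂ) ≠ 0 := by exact_mod_cast (PNat.ne_zero p₁)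
  have hQ : ((Q : ℕ) : ℂ) ≠ 0 := by exact_mod_cast (PNat.ne_zero Q)
  push_cast
  field_simp

/-- `x ≡ 0 (mod Q)` in `ℤ_P` means `x = Q·y`. [folklore] -/
theorem exists_eq_Q_mul_of_toQ_eq_zero {x : ZP p₁ Q} (h : toQ p₁ Q x = 0) :
    ∃ y : ZP p₁ Q, x = ((Q : ℕ) : ZP p₁ Q) * y := by
  have hx : ((x.val : ℕ) : ZQ Q) = 0 := by
    rw [← h, toQ, ZMod.castHom_apply, ZMod.cast_eq_val]
  obtain ⟨k, hk⟩ := (ZMod.natCast_eq_zero_iff _ _).1 hx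
  refine ⟨(k : ZP p₁ Q), ?_⟩
  rw [← ZMod.natCast_zmod_val x, hk, Nat.cast_mul]

/-- `p₁·Q = 0` in `ℤ_P`. [folklore] -/
theorem p₁_mul_Q_eq_zero : ((p₁ : ℕ) : ZP p₁ Q) * ((Q : ℕ) : ZP p₁ Q) = 0 := by
  rw [← Nat.cast_mul, ← PNat.mul_coe, ZMod.natCast_self]

/-- The vanishing mechanism of T4: a coefficient divisible by `p₁` times a residue `≡ 0 (mod Q)` is `0`
in `ℤ_P` — the unknown coordinates `b_i ∈ 2p₁ℤ` never meet a surviving frequency. [folklore] -/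
theorem intCast_mul_eq_zero_of_dvd {β : ℤ} (hβ : ((p₁ : ℕ) : ℤ) ∣ β) {x : ZP p₁ Q}
    (hx : toQ p₁ Q x = 0) : ((β : ℤ) : ZP p₁ Q) * x = 0 := by
  obtain ⟨β', rfl⟩ := hβ
  obtain ⟨y, rfl⟩ := exists_eq_Q_mul_of_toQ_eq_zero p₁ Q hx
  have hP := p₁_mul_Q_eq_zero p₁ Q
  push_cast
  linear_combination (β' : ZP p₁ Q) * y * hP

/-- An additive character of `ℤ_m` turns finite sums into products. [folklore] -/
theorem stdAddChar_finset_sum {m : ℕ} [NeZero m] {ι : Type*} (s : Finset ι) (x : ι → ZMod m) :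
    (ZMod.stdAddChar (∑ i ∈ s, x i) : ℂ) = ∏ i ∈ s, (ZMod.stdAddChar (x i) : ℂ) := by
  classical
  induction s using Finset.induction_on with
  | empty => simp
  | insert a s ha ih =>
      rw [Finset.sum_insert ha, Finset.prod_insert ha, AddChar.map_add_eq_mul, ih]

end ModQ

/-! ### The line Gauss sum: completing the square -/

section LineGauss

variable (p₁ Q : ℕ+)

/-- `G(t) = Σ_{j ∈ ℤ_P} ψ_P(−j² − 2tj)`, the sum in `qft_phi8bKet` at `t = lineFun u`.
[cite: ChenQuantumLattice2024, §3.5.9 p. 35; Korobov1992, Ch. I §3] -/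
noncomputable def lineGauss (t : ZP p₁ Q) : ℂ :=
  ∑ j : ZP p₁ Q, (ZMod.stdAddChar ((-1) * j ^ 2 + (-(2 * t)) * j) : ℂ)

/-- **Completing the square**: `G(t) = ψ_P(t²)·G(0)` (`−j² − 2tj = t² − (j+t)²`, reindex `j ↦ j + t`;
no inverse of `2` needed). [cite: Korobov1992, Ch. I §3] -/
theorem lineGauss_eq (t : ZP p₁ Q) :
    lineGauss p₁ Q t = ZMod.stdAddChar (t ^ 2) * lineGauss p₁ Q 0 := by
  unfold lineGauss
  rw [Finset.mul_sum]
  exact Fintype.sum_equiv (Equiv.addRight t) _ _ fun j => by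
    simp only [Equiv.coe_addRight]
    rw [← AddChar.map_add_eq_mul]
    congr 1
    ring

/-- `G(t)·conj G(t′) = ψ_P(t² − t′²)·(G(0)·conj G(0))`. [cite: Korobov1992, Ch. I §3] -/
theorem lineGauss_mul_conj (t t' : ZP p₁ Q) :
    lineGauss p₁ Q t * (starRingEnd ℂ) (lineGauss p₁ Q t')
      = ZMod.stdAddChar (t ^ 2 - t' ^ 2) * (lineGauss p₁ Q 0 * (starRingEnd ℂ) (lineGauss p₁ Q 0)) := by
  rw [lineGauss_eq p₁ Q t, lineGauss_eq p₁ Q t', map_mul (starRingEnd ℂ), ← AddChar.map_neg_eq_conj,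
    mul_mul_mul_comm,
    ← AddChar.map_add_eq_mul, ← sub_eq_add_neg]

/-- `|G(0)|² = P` for odd `P` (the flat-spectrum constant of T3; not needed for T4).
[cite: Korobov1992, Ch. I §3 Thm 3] -/
theorem norm_sq_lineGauss_zero (hP : Odd ((p₁ * Q : ℕ+) : ℕ)) :
    ‖lineGauss p₁ Q 0‖ ^ 2 = ((p₁ * Q : ℕ+) : ℕ) := by
  unfold lineGauss
  exact Literature.NumberTheory.GaussSums.norm_sq_sum_stdAddChar_quadratic _ hP (-1) _ isUnit_one.neg

end LineGauss

/-! ### Fourier-side Gram entries of `|φ8.b⟩` -/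

section Gram

variable (n : ℕ) (D p₁ Q : ℕ+)

/-- The Gram (density-matrix) entry of `QFT|φ8.b⟩` at `(u,u′)`:
`ρ̂_{b,v′}(u,u′) = QFT|φ8.b⟩(u) · conj QFT|φ8.b⟩(u′)` (unnormalised, Chen's `QFT`).
[cite: ChenQuantumLattice2024, Lemma 2.12 p. 12, §3.5.9 p. 35] -/
noncomputable def fourierGram (b v' : Fin (n + 1) → ℤ) (u u' : Fin (n + 1) → ZN D p₁ Q) : ℂ :=
  qft (phi8bKet n D p₁ Q b v') u * (starRingEnd ℂ) (qft (phi8bKet n D p₁ Q b v') u')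

/-- `QFT|φ8.b⟩(u) = ψ_N(−⟨v′,u⟩)·G(lineFun u)` (restating `qft_phi8bKet` with `lineGauss`).
[cite: ChenQuantumLattice2024, §3.5.9 p. 35] -/
theorem qft_phi8bKet_eq_lineGauss (b v' : Fin (n + 1) → ℤ) (u : Fin (n + 1) → ZN D p₁ Q) :
    qft (phi8bKet n D p₁ Q b v') u
      = ZMod.stdAddChar (-offsetFun n D p₁ Q v' u) * lineGauss p₁ Q (lineFun n D p₁ Q b u) :=
  qft_phi8bKet n D p₁ Q b v' u

/-- `offsetFun` is additive in the offset. [folklore] -/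
theorem offsetFun_add (v₁ v₂ : Fin (n + 1) → ℤ) (u : Fin (n + 1) → ZN D p₁ Q) :
    offsetFun n D p₁ Q (v₁ + v₂) u = offsetFun n D p₁ Q v₁ u + offsetFun n D p₁ Q v₂ u := by
  unfold offsetFun
  rw [← Finset.sum_add_distrib]
  refine Finset.sum_congr rfl fun i _ => ?_
  rw [Pi.add_apply, Int.cast_add, add_mul]

/-- `offsetFun` is additive in the outcome: `⟨v,u′⟩ − ⟨v,u⟩ = ⟨v, u′−u⟩`. [folklore] -/
theorem offsetFun_sub_right (v : Fin (n + 1) → ℤ) (u u' : Fin (n + 1) → ZN D p₁ Q) :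
    offsetFun n D p₁ Q v u' - offsetFun n D p₁ Q v u = offsetFun n D p₁ Q v (u' - u) := by
  unfold offsetFun
  rw [← Finset.sum_sub_distrib]
  refine Finset.sum_congr rfl fun i _ => ?_
  rw [Pi.sub_apply, mul_sub]

/-- `lineFun` is additive in the outcome: `t(u′) − t(u) = t(u′ − u)`. [folklore] -/
theorem lineFun_sub (b : Fin (n + 1) → ℤ) (u u' : Fin (n + 1) → ZN D p₁ Q) :
    lineFun n D p₁ Q b u' - lineFun n D p₁ Q b u = lineFun n D p₁ Q b (u' - u) := by
  unfold lineFun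
  rw [← Finset.sum_sub_distrib]
  refine Finset.sum_congr rfl fun i _ => ?_
  rw [Pi.sub_apply, map_sub, mul_sub]

/-- **Closed form of the Gram entries**:
`ρ̂_{b,v′}(u,u′) = ψ_N(⟨v′,u′−u⟩) · ψ_P(t(u)² − t(u′)²) · (G(0)·conj G(0))`, `t = lineFun b`.
[cite: ChenQuantumLattice2024, §3.5.9 p. 35; Korobov1992, Ch. I §3] -/
theorem fourierGram_eq (b v' : Fin (n + 1) → ℤ) (u u' : Fin (n + 1) → ZN D p₁ Q) :
    fourierGram n D p₁ Q b v' u u'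
      = ZMod.stdAddChar (offsetFun n D p₁ Q v' (u' - u))
        * ZMod.stdAddChar (lineFun n D p₁ Q b u ^ 2 - lineFun n D p₁ Q b u' ^ 2)
        * (lineGauss p₁ Q 0 * (starRingEnd ℂ) (lineGauss p₁ Q 0)) := by
  unfold fourierGram
  rw [qft_phi8bKet_eq_lineGauss, qft_phi8bKet_eq_lineGauss, map_mul (starRingEnd ℂ), ← AddChar.map_neg_eq_conj,
    neg_neg, mul_mul_mul_comm, ← AddChar.map_add_eq_mul, lineGauss_mul_conj, neg_add_eq_sub,
    offsetFun_sub_right, ← mul_assoc]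

/-- **Translation covariance**: shifting the offset by `d` multiplies `ρ̂(u,u′)` by the phase
`ψ_N(⟨d, u′−u⟩)`; Born weights (`u = u′`) are unchanged. [folklore] -/
theorem fourierGram_shift (b v' d : Fin (n + 1) → ℤ) (u u' : Fin (n + 1) → ZN D p₁ Q) :
    fourierGram n D p₁ Q b (v' + d) u u'
      = ZMod.stdAddChar (offsetFun n D p₁ Q d (u' - u)) * fourierGram n D p₁ Q b v' u u' := by
  rw [fourierGram_eq, fourierGram_eq, offsetFun_add, AddChar.map_add_eq_mul]
  ring

/-! ### The heart of T4: on the annihilator the unknown coordinates drop out -/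

/-- `lineFun` of a difference `η` with `η_i ≡ 0 (mod Q)` on `U` does not see the `U`-coordinates of `b`:
two vectors agreeing off `U` and divisible by `p₁` on `U` give the same `t(η)`.
[cite: ChenQuantumLattice2024, eq. (12) p. 17 (`b_i ∈ 2p₁ℤ`)] -/
theorem lineFun_eq_of_agree (U : Finset (Fin (n + 1))) (b b' : Fin (n + 1) → ℤ)
    (hb : ∀ i ∈ U, ((p₁ : ℕ) : ℤ) ∣ b i) (hb' : ∀ i ∈ U, ((p₁ : ℕ) : ℤ) ∣ b' i)
    (hagree : ∀ i, i ∉ U → b i = b' i) (η : Fin (n + 1) → ZN D p₁ Q)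
    (hcoord : ∀ i ∈ U, toQ p₁ Q (toP D (p₁ * Q) (η i)) = 0) :
    lineFun n D p₁ Q b η = lineFun n D p₁ Q b' η := by
  unfold lineFun
  refine Finset.sum_congr rfl fun i _ => ?_
  by_cases hi : i ∈ U
  · rw [intCast_mul_eq_zero_of_dvd p₁ Q (hb i hi) (hcoord i hi),
      intCast_mul_eq_zero_of_dvd p₁ Q (hb' i hi) (hcoord i hi)]
  · rw [hagree i hi]

/-- Under the same agreement, `t(η) mod Q` is the PUBLIC quantity `⟨bk, η mod P⟩ mod Q` for any `bk`
agreeing with `b` off `U`. [folklore] -/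
theorem toQ_lineFun_eq (U : Finset (Fin (n + 1))) (b bk : Fin (n + 1) → ℤ)
    (hbk : ∀ i, i ∉ U → bk i = b i) (η : Fin (n + 1) → ZN D p₁ Q)
    (hcoord : ∀ i ∈ U, toQ p₁ Q (toP D (p₁ * Q) (η i)) = 0) :
    toQ p₁ Q (lineFun n D p₁ Q b η) = toQ p₁ Q (lineFun n D p₁ Q bk η) := by
  unfold lineFun
  rw [map_sum, map_sum]
  refine Finset.sum_congr rfl fun i _ => ?_
  by_cases hi : i ∈ U
  · rw [map_mul, map_mul, hcoord i hi, mul_zero, mul_zero]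
  · rw [hbk i hi]

/-- The difference of the hyperplane functionals of two secrets agreeing off `U` is a multiple of `p₁`.
[cite: ChenQuantumLattice2024, eq. (12) p. 17] -/
theorem exists_lineFun_sub_eq_p₁_mul (U : Finset (Fin (n + 1))) (b b' : Fin (n + 1) → ℤ)
    (hb : ∀ i ∈ U, ((p₁ : ℕ) : ℤ) ∣ b i) (hb' : ∀ i ∈ U, ((p₁ : ℕ) : ℤ) ∣ b' i)
    (hagree : ∀ i, i ∉ U → b i = b' i) (u : Fin (n + 1) → ZN D p₁ Q) :
    ∃ ρ : ZP p₁ Q, lineFun n D p₁ Q b u - lineFun n D p₁ Q b' u = ((p₁ : ℕ) : ZP p₁ Q) * ρ := by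
  have hdvd : ∀ i, ((p₁ : ℕ) : ℤ) ∣ b i - b' i := by
    intro i
    by_cases hi : i ∈ U
    · exact dvd_sub (hb i hi) (hb' i hi)
    · rw [hagree i hi, sub_self]; exact dvd_zero _
  refine ⟨∑ i, (((b i - b' i) / ((p₁ : ℕ) : ℤ) : ℤ) : ZP p₁ Q) * toP D (p₁ * Q) (u i), ?_⟩
  unfold lineFun
  rw [← Finset.sum_sub_distrib, Finset.mul_sum]
  refine Finset.sum_congr rfl fun i _ => ?_
  rw [← sub_mul, ← Int.cast_sub, ← mul_assoc ((p₁ : ℕ) : ZP p₁ Q), ← Int.cast_natCast (R := ZP p₁ Q) (p₁ : ℕ),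
    ← Int.cast_mul, Int.mul_ediv_cancel' (hdvd i)]

/-- **The heart of T4.**  If `η = u′ − u` lies in the annihilator of the class (`η_i ≡ 0 (mod Q)` for
`i ∈ U` and `⟨bk, η mod P⟩ ≡ 0 (mod Q)`), the Gram entry `ρ̂_{b,v′}(u,u′)` is the same for any two
vectors `b, b′` agreeing off `U` and `≡ 0 (mod p₁)` on `U`: in `t(u)² − t(u′)² = −η·(2t(u) + t(η))`-type
expansions the secret enters only through `p₁·(Q·y) = 0`.  No parity / coprimality hypothesis.
[cite: ChenQuantumLattice2024, §3.5.9 p. 35, eq. (12) p. 17] -/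
theorem fourierGram_indep_of_ann (U : Finset (Fin (n + 1))) (bk b b' v' : Fin (n + 1) → ℤ)
    (hb : ∀ i ∈ U, ((p₁ : ℕ) : ℤ) ∣ b i) (hb' : ∀ i ∈ U, ((p₁ : ℕ) : ℤ) ∣ b' i)
    (hagree : ∀ i, i ∉ U → b i = b' i) (hbk : ∀ i, i ∉ U → bk i = b i)
    (u u' : Fin (n + 1) → ZN D p₁ Q)
    (hcoord : ∀ i ∈ U, toQ p₁ Q (toP D (p₁ * Q) ((u' - u) i)) = 0)
    (hline : toQ p₁ Q (lineFun n D p₁ Q bk (u' - u)) = 0) :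
    fourierGram n D p₁ Q b v' u u' = fourierGram n D p₁ Q b' v' u u' := by
  -- the algebra in `ℤ_P`: with `t = lineFun b u`, `T = lineFun b′ u`, `σ = lineFun b (u′−u) = lineFun b′ (u′−u)`,
  -- `t² − (t+σ)² − (T² − (T+σ)²) = −2σ(t − T) = −2·(Q y)·(p₁ ρ) = 0`.
  have e1 : lineFun n D p₁ Q b u' = lineFun n D p₁ Q b u + lineFun n D p₁ Q b (u' - u) := by
    rw [← lineFun_sub n D p₁ Q b u u']; ring
  have e3 : lineFun n D p₁ Q b' (u' - u) = lineFun n D p₁ Q b (u' - u) :=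
    (lineFun_eq_of_agree n D p₁ Q U b b' hb hb' hagree (u' - u) hcoord).symm
  have e2 : lineFun n D p₁ Q b' u' = lineFun n D p₁ Q b' u + lineFun n D p₁ Q b (u' - u) := by
    rw [← e3, ← lineFun_sub n D p₁ Q b' u u']; ring
  obtain ⟨ρ, e4⟩ := exists_lineFun_sub_eq_p₁_mul n D p₁ Q U b b' hb hb' hagree u
  have hσQ : toQ p₁ Q (lineFun n D p₁ Q b (u' - u)) = 0 := by
    rw [toQ_lineFun_eq n D p₁ Q U b bk hbk (u' - u) hcoord, hline]
  obtain ⟨y, e5⟩ := exists_eq_Q_mul_of_toQ_eq_zero p₁ Q hσQ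
  have hP := p₁_mul_Q_eq_zero p₁ Q
  have key : lineFun n D p₁ Q b u ^ 2 - lineFun n D p₁ Q b u' ^ 2
      = lineFun n D p₁ Q b' u ^ 2 - lineFun n D p₁ Q b' u' ^ 2 := by
    rw [e1, e2]
    linear_combination (-(2 * lineFun n D p₁ Q b (u' - u))) * e4
      + (-(2 * ((p₁ : ℕ) : ZP p₁ Q) * ρ)) * e5 + (-(2 * y * ρ)) * hP
  rw [fourierGram_eq, fourierGram_eq, key]

/-! ### The class shifts and the twirl -/

/-- The `U`-part of `c` as natural numbers: `c_i` (lifted to `[0,Q)`) for `i ∈ U`, `0` otherwise.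
[folklore] -/
def classTail (U : Finset (Fin (n + 1))) (c : Fin (n + 1) → ZQ Q) (i : Fin (n + 1)) : ℕ :=
  if i ∈ U then (c i).val else 0

/-- **The class shifts** `d(a,c) = D²p₁·(a·bk + c·𝟙_U) ∈ ℤ^{n+1}` (`a ∈ ℤ_Q`, `c ∈ ℤ_Q^{n+1}`, lifted
to `[0,Q)`): offsets `v′` and `v′ + d(a,c)` get the same Step-8 value `v′₀ mod D²p₁` and the same line
invariants (`REPAIR-CENSUS.md` §0; mod `N` and for odd `Q` they sweep exactly the residual class `K`).
[cite: ChenQuantumLattice2024, Claim 3.14 pp. 33–34, §3.5.9 p. 35] -/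
def classShift (U : Finset (Fin (n + 1))) (bk : Fin (n + 1) → ℤ) (a : ZQ Q) (c : Fin (n + 1) → ZQ Q) :
    Fin (n + 1) → ℤ :=
  fun i => ((D : ℕ) : ℤ) ^ 2 * ((p₁ : ℕ) : ℤ) * (((a.val : ℕ) : ℤ) * bk i + ((classTail n Q U c i : ℕ) : ℤ))

/-- The frequencies tested by the `c`-part of the twirl: `η_i mod Q` for `i ∈ U`, nothing otherwise.
[folklore] -/
def classFreq (U : Finset (Fin (n + 1))) (η : Fin (n + 1) → ZN D p₁ Q) (i : Fin (n + 1)) : ZQ Q :=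
  if i ∈ U then toQ p₁ Q (toP D (p₁ * Q) (η i)) else 0

/-- `toP ⟨bk, η⟩_N = lineFun bk η`. [folklore] -/
theorem toP_sum (bk : Fin (n + 1) → ℤ) (η : Fin (n + 1) → ZN D p₁ Q) :
    toP D (p₁ * Q) (∑ i, ((bk i : ℤ) : ZN D p₁ Q) * η i) = lineFun n D p₁ Q bk η := by
  simp only [lineFun, map_sum, map_mul, map_intCast]

/-- `⟨d(a,c), η⟩` split into its `a`-part and its `c`-part. [folklore] -/
theorem offsetFun_classShift (U : Finset (Fin (n + 1))) (bk : Fin (n + 1) → ℤ) (a : ZQ Q)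
    (c : Fin (n + 1) → ZQ Q) (η : Fin (n + 1) → ZN D p₁ Q) :
    offsetFun n D p₁ Q (classShift n D p₁ Q U bk a c) η
      = ((a.val : ℕ) : ZN D p₁ Q) * ((D : ℕ) : ZN D p₁ Q) ^ 2
          * (((p₁ : ℕ) : ZN D p₁ Q) * ∑ i, ((bk i : ℤ) : ZN D p₁ Q) * η i)
        + ∑ i, ((classTail n Q U c i : ℕ) : ZN D p₁ Q) * ((D : ℕ) : ZN D p₁ Q) ^ 2
          * (((p₁ : ℕ) : ZN D p₁ Q) * η i) := by
  unfold offsetFun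
  rw [Finset.mul_sum, Finset.mul_sum, ← Finset.sum_add_distrib]
  refine Finset.sum_congr rfl fun i _ => ?_
  simp only [classShift, Int.cast_mul, Int.cast_add, Int.cast_pow, Int.cast_natCast]
  ring

/-- **The character of a class shift**:
`ψ_N(⟨d(a,c), η⟩) = ψ_Q(a · (⟨bk,η mod P⟩ mod Q)) · Π_i ψ_Q(c_i · classFreq_i(η))`.
[folklore] -/
theorem stdAddChar_offsetFun_classShift (U : Finset (Fin (n + 1))) (bk : Fin (n + 1) → ℤ) (a : ZQ Q)
    (c : Fin (n + 1) → ZQ Q) (η : Fin (n + 1) → ZN D p₁ Q) :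
    (ZMod.stdAddChar (offsetFun n D p₁ Q (classShift n D p₁ Q U bk a c) η) : ℂ)
      = ZMod.stdAddChar (a * toQ p₁ Q (lineFun n D p₁ Q bk η))
        * ∏ i, (ZMod.stdAddChar (c i * classFreq n D p₁ Q U η i) : ℂ) := by
  rw [offsetFun_classShift, AddChar.map_add_eq_mul, stdAddChar_finset_sum]
  congr 1
  · rw [stdAddChar_natCast_mul_sq_mul, map_mul (toP D (p₁ * Q)), map_natCast (toP D (p₁ * Q)), toP_sum,
      show ((a.val : ℕ) : ZP p₁ Q) * (((p₁ : ℕ) : ZP p₁ Q) * lineFun n D p₁ Q bk η)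
        = ((p₁ : ℕ) : ZP p₁ Q) * (((a.val : ℕ) : ZP p₁ Q) * lineFun n D p₁ Q bk η) by ring,
      stdAddChar_p₁_mul, map_mul (toQ p₁ Q), map_natCast (toQ p₁ Q), ZMod.natCast_zmod_val]
  · refine Finset.prod_congr rfl fun i _ => ?_
    rw [stdAddChar_natCast_mul_sq_mul, map_mul (toP D (p₁ * Q)), map_natCast (toP D (p₁ * Q)),
      show ((classTail n Q U c i : ℕ) : ZP p₁ Q) * (((p₁ : ℕ) : ZP p₁ Q) * toP D (p₁ * Q) (η i))
        = ((p₁ : ℕ) : ZP p₁ Q) * (((classTail n Q U c i : ℕ) : ZP p₁ Q) * toP D (p₁ * Q) (η i)) by ring,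
      stdAddChar_p₁_mul, map_mul (toQ p₁ Q), map_natCast (toQ p₁ Q)]
    congr 1
    unfold classTail classFreq
    split_ifs with hi
    · rw [ZMod.natCast_zmod_val]
    · rw [Nat.cast_zero, zero_mul, mul_zero]

/-- **The twirl factor (character orthogonality on the class).**
`Σ_{a ∈ ℤ_Q} Σ_{c ∈ ℤ_Q^{n+1}} ψ_N(⟨d(a,c), η⟩) = Q·[⟨bk,η mod P⟩ ≡ 0 (mod Q)] · Π_i Q·[classFreq_i(η) = 0]`
— zero unless `η` annihilates the class. [folklore] -/
theorem twirlFactor_eq (U : Finset (Fin (n + 1))) (bk : Fin (n + 1) → ℤ) (η : Fin (n + 1) → ZN D p₁ Q) :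
    ∑ a : ZQ Q, ∑ c : Fin (n + 1) → ZQ Q,
        (ZMod.stdAddChar (offsetFun n D p₁ Q (classShift n D p₁ Q U bk a c) η) : ℂ)
      = (if toQ p₁ Q (lineFun n D p₁ Q bk η) = 0 then ((((Q : ℕ+) : ℕ) : ℂ)) else 0)
        * ∏ i, (if classFreq n D p₁ Q U η i = 0 then ((((Q : ℕ+) : ℕ) : ℂ)) else 0) := by
  simp_rw [stdAddChar_offsetFun_classShift]
  rw [← Finset.sum_mul_sum]
  congr 1
  · rw [AddChar.sum_mulShift _ (ZMod.isPrimitive_stdAddChar _), ZMod.card, Nat.cast_ite, Nat.cast_zero]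
  · rw [(Fintype.prod_sum fun i (y : ZQ Q) =>
        (ZMod.stdAddChar (y * classFreq n D p₁ Q U η i) : ℂ)).symm]
    refine Finset.prod_congr rfl fun i _ => ?_
    rw [AddChar.sum_mulShift _ (ZMod.isPrimitive_stdAddChar _), ZMod.card, Nat.cast_ite, Nat.cast_zero]

/-- **The class twirl** of the Fourier-side density matrix:
`ρ̄_{b,v′}(u,u′) = Σ_{a,c} ρ̂_{b, v′ + d(a,c)}(u,u′)` (unnormalised average of the run's state over all
offsets of the class of `v′`). [cite: ChenQuantumLattice2024, §3.5.9 p. 35] -/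
noncomputable def twirledGram (U : Finset (Fin (n + 1))) (bk b v' : Fin (n + 1) → ℤ)
    (u u' : Fin (n + 1) → ZN D p₁ Q) : ℂ :=
  ∑ a : ZQ Q, ∑ c : Fin (n + 1) → ZQ Q, fourierGram n D p₁ Q b (v' + classShift n D p₁ Q U bk a c) u u'

/-- The twirl acts entrywise by the twirl factor: `ρ̄(u,u′) = (Σ_{a,c} ψ_N(⟨d(a,c), u′−u⟩)) · ρ̂(u,u′)`.
[folklore] -/
theorem twirledGram_eq (U : Finset (Fin (n + 1))) (bk b v' : Fin (n + 1) → ℤ)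
    (u u' : Fin (n + 1) → ZN D p₁ Q) :
    twirledGram n D p₁ Q U bk b v' u u'
      = (∑ a : ZQ Q, ∑ c : Fin (n + 1) → ZQ Q,
          (ZMod.stdAddChar (offsetFun n D p₁ Q (classShift n D p₁ Q U bk a c) (u' - u)) : ℂ))
        * fourierGram n D p₁ Q b v' u u' := by
  unfold twirledGram
  simp_rw [fourierGram_shift]
  rw [Finset.sum_mul]
  refine Finset.sum_congr rfl fun a _ => ?_
  rw [Finset.sum_mul]

/-- **T4 (class-twirl no-go).**  For any two vectors `b, b′` that agree off the unknown set `U` and are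
`≡ 0 (mod p₁)` on `U` (two LWE instances with the same planted part, eq. (12)), any public generator `bk`
agreeing with them off `U`, every offset `v′` and all outcomes `u, u′`:
`ρ̄_{b,v′}(u,u′) = ρ̄_{b′,v′}(u,u′)` — the class-averaged density operator of `QFT|φ8.b⟩` is the SAME
operator for both secrets.  No parity or coprimality hypothesis is used.
[cite: ChenQuantumLattice2024, §3.5.9 pp. 34–38, eq. (12) p. 17; ZhangExactCoset2025, p. 22 (AC4)] -/
theorem twirledGram_secret_indep (U : Finset (Fin (n + 1))) (bk b b' v' : Fin (n + 1) → ℤ)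
    (hb : ∀ i ∈ U, ((p₁ : ℕ) : ℤ) ∣ b i) (hb' : ∀ i ∈ U, ((p₁ : ℕ) : ℤ) ∣ b' i)
    (hagree : ∀ i, i ∉ U → b i = b' i) (hbk : ∀ i, i ∉ U → bk i = b i)
    (u u' : Fin (n + 1) → ZN D p₁ Q) :
    twirledGram n D p₁ Q U bk b v' u u' = twirledGram n D p₁ Q U bk b' v' u u' := by
  rw [twirledGram_eq, twirledGram_eq, twirlFactor_eq]
  by_cases hline : toQ p₁ Q (lineFun n D p₁ Q bk (u' - u)) = 0
  · by_cases hcoord : ∀ i ∈ U, toQ p₁ Q (toP D (p₁ * Q) ((u' - u) i)) = 0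
    · rw [fourierGram_indep_of_ann n D p₁ Q U bk b b' v' hb hb' hagree hbk u u' hcoord hline]
    · push Not at hcoord
      obtain ⟨i, hi, hne⟩ := hcoord
      have hz : (∏ i, (if classFreq n D p₁ Q U (u' - u) i = 0 then ((((Q : ℕ+) : ℕ) : ℂ)) else 0))
          = 0 := by
        refine Finset.prod_eq_zero (Finset.mem_univ i) ?_
        rw [if_neg]
        unfold classFreq
        rwa [if_pos hi]
      rw [hz, mul_zero, zero_mul, zero_mul]
  · rw [if_neg hline, zero_mul, zero_mul, zero_mul]

/-- `lineFun` vanishes at `0`. [folklore] -/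
theorem lineFun_zero (bk : Fin (n + 1) → ℤ) : lineFun n D p₁ Q bk 0 = 0 := by
  unfold lineFun
  refine Finset.sum_eq_zero fun i _ => ?_
  rw [Pi.zero_apply, map_zero, mul_zero]

/-- `classFreq` vanishes at `η = 0`. [folklore] -/
theorem classFreq_zero (U : Finset (Fin (n + 1))) (i : Fin (n + 1)) : classFreq n D p₁ Q U 0 i = 0 := by
  unfold classFreq
  rw [Pi.zero_apply, map_zero, map_zero, ite_self]

/-- The diagonal Gram entry is the Born weight: `ρ̂(u,u) = |QFT|φ8.b⟩(u)|² = P` (odd `P`, T3).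
[cite: ChenQuantumLattice2024, §3.5.9 p. 35; Korobov1992, Ch. I §3 Thm 3] -/
theorem fourierGram_self (hP : Odd ((p₁ * Q : ℕ+) : ℕ)) (b v' : Fin (n + 1) → ℤ)
    (u : Fin (n + 1) → ZN D p₁ Q) :
    fourierGram n D p₁ Q b v' u u = ((((p₁ * Q : ℕ+) : ℕ) : ℂ)) := by
  have hw := weight_qft_phi8bKet n D p₁ Q b v' hP u
  unfold weight at hw
  rw [fourierGram, Complex.mul_conj, Complex.normSq_eq_norm_sq, hw]
  norm_cast

/-- **Non-vacuity**: the twirled operator is not zero — its diagonal is `ρ̄(u,u) = Q^{n+2}·P` for every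
`u` (odd `P`): the twirl factor at `η = 0` counts the `Q·Q^{n+1}` parameters `(a,c)` and the diagonal
entry is T3's flat weight `P`.  So `twirledGram_secret_indep` equates two genuinely non-trivial operators.
[cite: ChenQuantumLattice2024, §3.5.9 p. 35] -/
theorem twirledGram_self (hP : Odd ((p₁ * Q : ℕ+) : ℕ)) (U : Finset (Fin (n + 1)))
    (bk b v' : Fin (n + 1) → ℤ) (u : Fin (n + 1) → ZN D p₁ Q) :
    twirledGram n D p₁ Q U bk b v' u u
      = ((((Q : ℕ+) : ℕ) : ℂ)) ^ (n + 2) * ((((p₁ * Q : ℕ+) : ℕ) : ℂ)) := by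
  rw [twirledGram_eq, twirlFactor_eq, sub_self, lineFun_zero, map_zero, if_pos rfl,
    fourierGram_self n D p₁ Q hP]
  simp only [classFreq_zero, if_true, Finset.prod_const, Finset.card_univ, Fintype.card_fin]
  ring

/-- **Every statistic of the averaged state is secret-blind.**  For any matrix `E` on the Fourier side
(a POVM element after any unitary post-processing of ALL `n+1` registers, an observable, …):
`Σ_{u,u′} E(u,u′)·ρ̄_{b,v′}(u,u′) = Σ_{u,u′} E(u,u′)·ρ̄_{b′,v′}(u,u′)`.  This is the census's T4 corollary
(a)/(b): an offset-oblivious post-processing cannot distinguish the secrets of one instance class.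
[cite: ChenQuantumLattice2024, §3.5.9 pp. 34–38] -/
theorem twirl_statistic_indep (U : Finset (Fin (n + 1))) (bk b b' v' : Fin (n + 1) → ℤ)
    (hb : ∀ i ∈ U, ((p₁ : ℕ) : ℤ) ∣ b i) (hb' : ∀ i ∈ U, ((p₁ : ℕ) : ℤ) ∣ b' i)
    (hagree : ∀ i, i ∉ U → b i = b' i) (hbk : ∀ i, i ∉ U → bk i = b i)
    (E : (Fin (n + 1) → ZN D p₁ Q) → (Fin (n + 1) → ZN D p₁ Q) → ℂ) :
    ∑ u, ∑ u', E u u' * twirledGram n D p₁ Q U bk b v' u u'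
      = ∑ u, ∑ u', E u u' * twirledGram n D p₁ Q U bk b' v' u u' :=
  Finset.sum_congr rfl fun u _ => Finset.sum_congr rfl fun u' _ => by
    rw [twirledGram_secret_indep n D p₁ Q U bk b b' v' hb hb' hagree hbk u u']

/-- **Many independent runs.**  Offsets of different runs are independent, so the jointly averaged state
of `r` runs is the tensor product of the per-run averages and its Gram entries are products: they, too,
are the same for `b` and `b′` (adaptive / collective measurements across runs included).
[cite: ChenQuantumLattice2024, §3.5.9 pp. 34–38; ZhangExactCoset2025, p. 5] -/
theorem twirl_multiRun_indep {r : ℕ} (U : Finset (Fin (n + 1))) (bk b b' : Fin (n + 1) → ℤ)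
    (hb : ∀ i ∈ U, ((p₁ : ℕ) : ℤ) ∣ b i) (hb' : ∀ i ∈ U, ((p₁ : ℕ) : ℤ) ∣ b' i)
    (hagree : ∀ i, i ∉ U → b i = b' i) (hbk : ∀ i, i ∉ U → bk i = b i)
    (vs : Fin r → (Fin (n + 1) → ℤ)) (us us' : Fin r → (Fin (n + 1) → ZN D p₁ Q)) :
    ∏ k, twirledGram n D p₁ Q U bk b (vs k) (us k) (us' k)
      = ∏ k, twirledGram n D p₁ Q U bk b' (vs k) (us k) (us' k) :=
  Finset.prod_congr rfl fun k _ =>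
    twirledGram_secret_indep n D p₁ Q U bk b b' (vs k) hb hb' hagree hbk (us k) (us' k)

end Gram

end Literature.Computability.Cryptography.Chen2024

/-! ### The `Steps` rendering: T4 for every admissible shape -/

namespace Literature.Computability.Cryptography.Chen2024.Shape

open scoped BigOperators

variable (S : Shape)

/-- The Gram entries of `QFT|φ8.b⟩` of a shape are `fourierGram` at the shape's `b, v′`.
[cite: ChenQuantumLattice2024, §3.5.9 p. 35] -/
theorem fourierGram_phi8b (u u' : Fin (S.n + 1) → ZMod S.N) :
    qft S.phi8b u * (starRingEnd ℂ) (qft S.phi8b u') = fourierGram S.n S.D S.p₁ S.Q S.b S.v' u u' := by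
  rw [phi8b_eq_phi8bKet]
  rfl

/-- **T4 for every admissible shape.**  Let `U ∌ 0` be any set of coordinates (the unknown ones), `b₂`
any integer vector with the same entries as `S.b` off `U` and `2p₁ ∣ b₂` on `U` (another LWE instance with
the same planted part, eq. (12)), `bk` any public vector agreeing with `S.b` off `U`.  Then for every
offset `v′` and all `u, u′` the class-twirled Gram entries of the two instances coincide.
[cite: ChenQuantumLattice2024, §3.5.9 pp. 34–38, eq. (12) p. 17, Cond. C.3 p. 18] -/
theorem twirledGram_indep (h : S.Admissible) (U : Finset (Fin (S.n + 1))) (hU : (0 : Fin (S.n + 1)) ∉ U)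
    (b₂ bk : Fin (S.n + 1) → ℤ) (hb₂U : ∀ i ∈ U, (2 * (S.p₁ : ℤ)) ∣ b₂ i)
    (hb₂ : ∀ i, i ∉ U → b₂ i = S.b i) (hbk : ∀ i, i ∉ U → bk i = S.b i)
    (v' : Fin (S.n + 1) → ℤ) (u u' : Fin (S.n + 1) → ZMod S.N) :
    twirledGram S.n S.D S.p₁ S.Q U bk S.b v' u u' = twirledGram S.n S.D S.p₁ S.Q U bk b₂ v' u u' := by
  refine twirledGram_secret_indep S.n S.D S.p₁ S.Q U bk S.b b₂ v' (fun i hi => ?_) (fun i hi => ?_)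
    (fun i hi => (hb₂ i hi).symm) hbk u u'
  · have hi0 : i ≠ 0 := fun h0 => hU (h0 ▸ hi)
    exact (Dvd.intro_left _ rfl : ((S.p₁ : ℕ) : ℤ) ∣ 2 * (S.p₁ : ℤ)).trans (h.b_tail i hi0)
  · exact (Dvd.intro_left _ rfl : ((S.p₁ : ℕ) : ℤ) ∣ 2 * (S.p₁ : ℤ)).trans (hb₂U i hi)

end Literature.Computability.Cryptography.Chen2024.Shape
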